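import Summits.Schanuel.Schanuel.Theorems.ZilberEacTorusRuledPeriodic
import Summits.Schanuel.Schanuel.Theorems.ZilberEacTorusRuledExamples
import Literature.ModelTheory.Zilber.EACPeriodicModels
import Literature.ModelTheory.Zilber.EACGraphEscapeModels
import HarnessLib

/-!
# Torus-ruled varieties, IV: the periodic half — certified family and a model over `x₃ = x₁²`

Zilber's Exponential-Algebraic Closedness, case ladder (host summit Schanuel, cell `pub-schanuel`,
seat 2, gen 4).  Instances of Theorem C′ (`inter_expGraph_nonempty_of_isTorusStable_of_indep_period`,
`ZilberEacTorusRuledPeriodic.lean`) with CERTIFIED cell membership (`EACGraphFibres`):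

* (period vectors of the base of a graph-fibre variety are those of the graph base:
  `isPeriodVec_projAdd_graphFibreVariety` of `EACPeriodicModels`);
* the **monomial-fibre family over a PERIODIC graph base** `x₃ = g(x₁, x₂)` (`deg g ≥ 2`, `A`
  dominant): if the ruling direction `(κ₁, κ₂, 1)` is ℤ-independent of a period vector `v` of the
  base, the variety meets `Γ_exp` — `∃ x, e^{xⱼ} = Aⱼ(x) e^{κⱼ g(x)}`
  (`exists_exp_eq_mul_exp_pow_of_indep_period`);
* **model over the parabolic cylinder `x₃ = x₁²`** (period `e₂`) with crossed proportional fibres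
  `y₁ = x₂ y₃`, `y₂ = x₁ y₃` (ruling direction `(1,1,1)`): a certified member of `ECCellPeriodic 2`
  meeting `Γ_exp`, i.e. `∃ z w, e^z = w·e^{z²} ∧ e^w = z·e^{z²}`
  (`sqBase_crossedProportional_model_system_solvable`).

Honest framing: certified INSTANCES of the open cell's periodic piece, settled by the structural
theorem; `ECCell 3 2` stays OPEN; nothing here bears on Schanuel's conjecture; EAC ⇏ SC.
-/

noncomputable section

open MvPolynomial Matrix
open Literature.NumberTheory.Transcendental Literature.ModelTheory.Zilber

set_option linter.dupNamespace false

namespace Summit.Schanuel.Schanuel.Theorems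

variable {s : ℕ}

/-- **The monomial-fibre family over a periodic graph base meets `Γ_exp` when the ruling direction
is independent of the period** (`s = 2`, `deg g ≥ 2`, `A` dominant): the variety
`{x₃ = g(x'), yⱼ = Aⱼ(x') y₃^{κⱼ}}` is irreducible, additively free with `addProjDim = 2`
(`ecCell_hypotheses_graphFibreVariety`), torus-ruled in the direction `(κ, 1)`, and Theorem C′
applies. [cite: AslanyanKirbyMantova2021, Thm. 1.5] -/
theorem graphFibreVariety_monomial_inter_expGraph_nonempty_of_indep_period
    (g : MvPolynomial (Fin 2) ℂ) (hg : 2 ≤ g.totalDegree) {v : Fin (2 + 1) → ℤ} (hv0 : v ≠ 0)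
    (hv : IsPeriodVec ℂ (graphBase g) v) (A : Fin 2 → MvPolynomial (Fin 2) ℂ)
    (hA : Function.Injective (aeval A : MvPolynomial (Fin 2) ℂ →ₐ[ℂ] MvPolynomial (Fin 2) ℂ))
    (κ : Fin 2 → ℕ) (hind : ∀ a b : ℤ, a • monomialDir κ = b • v → a = 0 ∧ b = 0) :
    (graphFibreVariety g (monomialFibrePoly A κ) ∩ expGraph ℂ (2 + 1)).Nonempty := by
  have hP : Function.Injective (aeval (fibreSlice (monomialFibrePoly A κ) 1) :
      MvPolynomial (Fin 2) ℂ →ₐ[ℂ] MvPolynomial (Fin 2) ℂ) := by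
    rw [fibreSlice_monomialFibrePoly_one]
    exact hA
  obtain ⟨hW, -, -, hadd, -, -, hbase⟩ :=
    ecCell_hypotheses_graphFibreVariety g (monomialFibrePoly A κ) 1 hP hg
  exact inter_expGraph_nonempty_of_isTorusStable_of_indep_period hW hadd hbase hv0
    (isPeriodVec_projAdd_graphFibreVariety g _ 1 hP hv)
    (isTorusStable_graphFibreVariety_monomial A κ g) hind

/-- **System form** (periodic graph base, independent ruling direction): `∃ x ∈ ℂ²`,
`e^{xⱼ} = Aⱼ(x) · e^{κⱼ g(x)}` for `j = 1, 2`. [cite: AslanyanKirbyMantova2021, Thm. 1.5] -/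
theorem exists_exp_eq_mul_exp_pow_of_indep_period
    (g : MvPolynomial (Fin 2) ℂ) (hg : 2 ≤ g.totalDegree) {v : Fin (2 + 1) → ℤ} (hv0 : v ≠ 0)
    (hv : IsPeriodVec ℂ (graphBase g) v) (A : Fin 2 → MvPolynomial (Fin 2) ℂ)
    (hA : Function.Injective (aeval A : MvPolynomial (Fin 2) ℂ →ₐ[ℂ] MvPolynomial (Fin 2) ℂ))
    (κ : Fin 2 → ℕ) (hind : ∀ a b : ℤ, a • monomialDir κ = b • v → a = 0 ∧ b = 0) :
    ∃ x : Fin 2 → ℂ, ∀ j, Complex.exp (x j) = eval x (A j) * Complex.exp (eval x g) ^ κ j := by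
  have h := graphFibreVariety_monomial_inter_expGraph_nonempty_of_indep_period g hg hv0 hv A hA κ hind
  rw [graphFibreVariety_inter_expGraph_nonempty_iff] at h
  obtain ⟨x, hx⟩ := h
  exact ⟨x, fun j => by rw [hx j, eval_cons_monomialFibrePoly]⟩

/-! ## The model over the parabolic cylinder `x₃ = x₁²` with crossed proportional fibres -/

/-- **The crossed proportional model over `x₃ = x₁²`**: the 3-fold
`{x₃ = x₁², y₁ = x₂ y₃, y₂ = x₁ y₃} ⊆ ℂ³ × ℂ³` (graph base `sqBase = X₀²` of `EACPeriodicModels`,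
period vector `e₂`; ruling direction `(1, 1, 1)`). [folklore] -/
def sqBaseCrossedModel : Set (Fin (2 + 1) ⊕ Fin (2 + 1) → ℂ) :=
  graphFibreVariety sqBase (monomialFibrePoly (![X 1, X 0] : Fin 2 → MvPolynomial (Fin 2) ℂ) ![1, 1])

/-- The ruling direction `(1,1,1)` is ℤ-independent of the period `e₂` of `x₃ = x₁²`. [folklore] -/
theorem monomialDir_one_one_indep_single :
    ∀ a b : ℤ, a • monomialDir (![1, 1] : Fin 2 → ℕ) = b • (Pi.single (1 : Fin (2 + 1)) 1) →
      a = 0 ∧ b = 0 := by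
  intro a b h
  have h0 := congr_fun h 0
  have h1 := congr_fun h 1
  have e0 : monomialDir (![1, 1] : Fin 2 → ℕ) 0 = 1 := by
    rw [show (0 : Fin (2 + 1)) = Fin.castSucc (0 : Fin 2) from rfl, monomialDir_castSucc]
    rfl
  have e1 : monomialDir (![1, 1] : Fin 2 → ℕ) 1 = 1 := by
    rw [show (1 : Fin (2 + 1)) = Fin.castSucc (1 : Fin 2) from rfl, monomialDir_castSucc]
    rfl
  simp only [Pi.smul_apply, smul_eq_mul, e0, e1, mul_one] at h0 h1
  have ha : a = 0 := by simpa using h0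
  refine ⟨ha, ?_⟩
  rw [ha] at h1
  simpa using h1.symm

/-- **The crossed model is a certified member of the periodic half of `EC(3,2)`** (binders of
`ECCellPeriodic 2` in order: irreducible closed, meets `G³`, rotund, additively free,
multiplicatively free, `dim = 3`, `addProjDim = 2`, periodic base) **and is torus-ruled** in the
direction `(1,1,1)`. [folklore] -/
theorem ecCellPeriodic_hypotheses_sqBaseCrossedModel :
    IsIrreducibleClosed ℂ sqBaseCrossedModel ∧
    (sqBaseCrossedModel ∩ torusLocus ℂ (2 + 1)).Nonempty ∧
    IsRotund ℂ (2 + 1) (sqBaseCrossedModel ∩ torusLocus ℂ (2 + 1)) ∧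
    IsAddFree ℂ (2 + 1) (sqBaseCrossedModel ∩ torusLocus ℂ (2 + 1)) ∧
    IsMulFree ℂ (2 + 1) (sqBaseCrossedModel ∩ torusLocus ℂ (2 + 1)) ∧
    zariskiDim ℂ sqBaseCrossedModel = (2 + 1 : ℕ) ∧
    addProjDim ℂ (2 + 1) sqBaseCrossedModel = (2 : ℕ) ∧
    HasIntegerPeriod ℂ (projAdd '' (sqBaseCrossedModel ∩ torusLocus ℂ (2 + 1))) ∧
    IsTorusStable (monomialDir ![1, 1]) (sqBaseCrossedModel ∩ torusLocus ℂ (2 + 1)) := by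
  have hP : Function.Injective (aeval (fibreSlice
      (monomialFibrePoly (![X 1, X 0] : Fin 2 → MvPolynomial (Fin 2) ℂ) ![1, 1]) 1) :
      MvPolynomial (Fin 2) ℂ →ₐ[ℂ] MvPolynomial (Fin 2) ℂ) := by
    rw [fibreSlice_monomialFibrePoly_one]
    exact aeval_swap_injective
  have hg : 2 ≤ sqBase.totalDegree := by rw [totalDegree_sqBase]
  obtain ⟨hW, hne, hrot, hadd, hmul, hdim, hbase, hper⟩ :=
    ecCellPeriodic_hypotheses_graphFibreVariety sqBase _ 1 hP hg
      ⟨_, fun h => by simpa using congr_fun h 1, isPeriodVec_graphBase_sqBase⟩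
  exact ⟨hW, hne, hrot, hadd, hmul, hdim, hbase, hper, isTorusStable_graphFibreVariety_monomial _ _ _⟩

/-- **The crossed model meets the graph of `exp`** (Theorem C′: period `e₂`, ruling direction
`(1,1,1)`). [cite: AslanyanKirbyMantova2021, Thm. 1.5] -/
theorem sqBaseCrossedModel_inter_expGraph_nonempty :
    (sqBaseCrossedModel ∩ expGraph ℂ (2 + 1)).Nonempty :=
  graphFibreVariety_monomial_inter_expGraph_nonempty_of_indep_period sqBase
    (by rw [totalDegree_sqBase]) (fun h => by simpa using congr_fun h 1) isPeriodVec_graphBase_sqBase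
    _ aeval_swap_injective _ monomialDir_one_one_indep_single

/-- **Model system over the parabolic cylinder with crossed proportional fibres**:
`∃ z w ∈ ℂ, e^z = w · e^{z²} ∧ e^w = z · e^{z²}`. [cite: AslanyanKirbyMantova2021, Thm. 1.5] -/
theorem sqBase_crossedProportional_model_system_solvable :
    ∃ z w : ℂ, Complex.exp z = w * Complex.exp (z ^ 2) ∧ Complex.exp w = z * Complex.exp (z ^ 2) := by
  obtain ⟨x, hx⟩ := exists_exp_eq_mul_exp_pow_of_indep_period sqBase (by rw [totalDegree_sqBase])
    (fun h => by simpa using congr_fun h 1) isPeriodVec_graphBase_sqBase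
    (![X 1, X 0] : Fin 2 → MvPolynomial (Fin 2) ℂ) aeval_swap_injective ![1, 1]
    monomialDir_one_one_indep_single
  refine ⟨x 0, x 1, ?_, ?_⟩
  · have h := hx 0
    simp only [eval_X, Matrix.cons_val_zero, pow_one, eval_sqBase] at h
    exact h
  · have h := hx 1
    simp only [eval_X, Matrix.cons_val_one, Matrix.cons_val_zero, pow_one, eval_sqBase] at h
    exact h

end Summit.Schanuel.Schanuel.Theorems
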